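import Summits.QuantumFields.YangMills.Theorems.ForcedResponseSkewnessResponseLocalisationSmearedDefs
import Summits.QuantumFields.YangMills.Theorems.ForcedResponseSkewnessResponseLocalisationContactOfFemtoToolkit
import Summits.QuantumFields.YangMills.Theorems.BalabanLadderNTBoundaryLawOscillation
import Summits.QuantumFields.YangMills.Theorems.LangevinControlUVOSLegsAtWeakCouplingCStubInheritTorus
import HarnessLib

/-!
# Route `ForcedResponseSkewness`, crux `ResponseLocalisation` (rev 6, stmt-QuantumFields-26871), line
# «signed-femto-collar»: the AF stub `SymNearCovLaw` only needs the CENTRE of CENTRED cubes, in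
# reference-free OSCILLATION form — TOOLKIT (geometry, translation, law of total covariance, arithmetic)

Helper file (`--supports stmt-QuantumFields-26871`) of the lead prover `ym-line-frs-p1` (g5).  The registered
physics stub `stub_symNearCovLaw : SymNearCovLawSigR` asks for the signed, radially smeared near-pair
conditional-covariance law `SymNearCovLaw G r a`
(`Theorems/ForcedResponseSkewnessResponseLocalisationSmearedDefs.lean`): reference values `n_β(w)` and a bound
`|Σ_w φ(a β‖w‖)(kerCov_η^{Q}(dens (z+w), dens z) − n_β(w))| ≤ κ / depth(z)⁴` for EVERY femto cube `Q`, EVERY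
exterior `η` and EVERY deep site `z`.  An engine (multi-scale expansion in a cube with a prescribed exterior)
never produces reference values and works on its own cubes; this file proves — unconditionally, by DLR
consistency and the frozen-boundary law `FBL` (the line's other stub, `fbl_of_fbl6 ∘ stub_fbl6Pinned`) — that
the following ONE-PARAMETER, REFERENCE-FREE statement suffices:

  for `β ≥ β₂`, every radius `N` with `(2N+1)·a β ≤ ℓ₂`, `R/a β + 2 ≤ N+1`, `d₀ ≤ a β·(N+1)`, every PAIR of
  exteriors `η, η'` of the centred cube `[-N, N]⁴` and every radial profile `|φ| ≤ 1` vanishing on `[R, ∞)`: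
  `|Σ_w φ(a β‖w‖)·(kerCov_η^{[-N,N]⁴}(dens w, dens 0) − kerCov_{η'}^{[-N,N]⁴}(dens w, dens 0))| ≤ κ/(N+1)⁴`

(`symNearCovLaw_of_centredOsc`).  Mechanism: for a deep site `z` of a cube `Q` the centred cube `Q'` of radius
`depth − 1` around `z` fits (`centredCube_subset_of_le_depth`); the law of total covariance through `Q'`
(`abs_cov_sub_integral_condCov_le`, DLR consistency `kerE_kerE_of_subset`) writes the `Q`-covariance as the
`Q`-average of the `Q'`-covariances plus the covariance of the `Q'`-kernel MEANS, and the latter is second order in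
the boundary law: `≤ 4·(16 C₁/D⁴)·(C₁/D⁴)` per pair, summed over the `≤ (2R/a β + 1)⁴` lattice points of the ball —
a total `≤ 5184 C₁² ((2R + a β)/d₀)⁴ / D⁴`, which the line's freedom to shrink the cut `R` after `κ, d₀` (and
`a β → 0`) makes `≤ κ/(4D⁴)`.  The reference values are the unit-exterior covariances of the largest admissible
centred cube; translation covariance (`kerE_configShift`) moves every centred cube to the origin.

* §1 geometry of centred cubes and lattice balls (`le_depth_centred_of_norm_le`, `card_filter_norm_lt_le_pow`);
* §2 translation of cube covariances (`kerCov_configShift`, `kerCov_dens_centred_eq`), continuity in the exterior;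
* §3 the law of total covariance for one pair (`abs_kerCov_sub_kerE_kerCov_le`) and for a weighted sum
  (`abs_wsum_kerCov_sub_kerE_le`);
* §4 arithmetic of the reduction (`floor_radius_admissible`, `sum_abs_weight_le`, `remainder_le`).
The reduction itself (`symNearCovLaw_of_centredOsc`, pinned form `symNearCovLawSigR_of_centredOsc`) is the sibling file
`ForcedResponseSkewnessResponseLocalisationSymNearCovOfCentredOsc.lean` (400-line cap).

No summit is proved by any of this (leaf R2a `BalabanLadder.NT`, conditional rung line; the AF law itself, the crux,
NT and the YM mass gap are NOT proved).  Refs: Georgii 2011 Def. 1.23 (iii) / Thm. 4.17 (consistency, DLR kernels);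
Friedli–Velenik 2017 (6.34) (law of total covariance); Bałaban 1989 (CMP 122) p. 356 (observables announced only).
-/

set_option autoImplicit false

noncomputable section

open MeasureTheory Filter Topology
open Literature.MathematicalPhysics.QuantumFieldTheory Literature.MathematicalPhysics.QuantumLattice
open Literature.Probability.LatticeModels
open Summit.QuantumFields.YangMills.Cruxes.OSLegsFromFemtoAndGap.DlrCollarTransfer
open Summit.QuantumFields.YangMills.Cruxes.OSLegsFromFemtoAndGap.DlrCollarTransfer.StubLower
  (le_depth_cube exists_abs_dens_le)
open Summit.QuantumFields.YangMills.Theorems.OSLegsFromFemtoAndGap.StubLower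
  (integrable_of_continuous_compact abs_integral_sub_const_le)
open Summit.QuantumFields.YangMills.Cruxes.OSLegsAtWeakCouplingC.InheritedAmplitudeGates.StubInherit
  (abs_cov_sub_integral_condCov_le)
open Summit.QuantumFields.YangMills.Cruxes.NT.BoundaryLaw
open Summit.QuantumFields.YangMills.Cruxes.ResponseLocalisation.Birth
open Summit.QuantumFields.YangMills.Cruxes.ResponseLocalisation.Femto (abs_apply_le_norm)

namespace Summit.QuantumFields.YangMills.Cruxes.ResponseLocalisation.CentredOsc

/-! ## §1 Geometry: centred cubes and lattice balls -/

/-- Depth in the centred cube of radius `N` around `z` of a site `z + w` with `‖w‖ ≤ ρ`: at least `N + 1 − ρ`.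
[folklore] -/
theorem le_depth_centred_of_norm_le (z w : Fin 4 → ℤ) (N : ℕ) {ρ : ℝ} (hw : ‖siteToE w‖ ≤ ρ) :
    (N : ℝ) + 1 - ρ ≤ (depth (fun j => z j - N) (2 * N + 1) (z + w) : ℝ) :=
  le_depth_cube z (z + w) N fun j => by
    have h := abs_apply_le_norm w j
    have e : (((z + w) j : ℤ) : ℝ) - z j = ((w j : ℤ) : ℝ) := by push_cast [Pi.add_apply]; ring
    rw [e]
    exact h.trans hw

/-- The centre of the centred cube of radius `N` has depth at least `N + 1`. [folklore] -/
theorem le_depth_centre (z : Fin 4 → ℤ) (N : ℕ) :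
    (N : ℝ) + 1 ≤ (depth (fun j => z j - N) (2 * N + 1) z : ℝ) := by
  have h := le_depth_cube z z N (t := 0) fun j => by simp
  simpa using h

/-- **Counting a lattice ball**: a finite set of lattice vectors has at most `(2ρ+1)⁴` members of Euclidean norm
`< ρ`. [folklore] -/
theorem card_filter_norm_lt_le_pow (B : Finset (Fin 4 → ℤ)) {ρ : ℝ} (hρ : 0 ≤ ρ) :
    (((B.filter fun w => ‖siteToE w‖ < ρ).card : ℕ) : ℝ) ≤ (2 * ρ + 1) ^ 4 := by
  classical
  set N : ℕ := ⌊ρ⌋₊ with hN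
  set T : Finset (Fin 4 → ℤ) := Fintype.piFinset fun _ : Fin 4 => Finset.Icc (-(N : ℤ)) N with hT
  have hsub : (B.filter fun w => ‖siteToE w‖ < ρ) ⊆ T := by
    intro w hw
    rw [Finset.mem_filter] at hw
    rw [hT, Fintype.mem_piFinset]
    intro k
    rw [Finset.mem_Icc]
    have h1 : |((w k : ℤ) : ℝ)| < ρ := (abs_apply_le_norm w k).trans_lt hw.2
    have h2 : |w k| ≤ (N : ℤ) := by
      have h5 : ((|w k| : ℤ) : ℝ) < (N : ℝ) + 1 := by
        have h3 : ((|w k| : ℤ) : ℝ) < ρ := by push_cast; exact h1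
        exact h3.trans (by rw [hN]; exact Nat.lt_floor_add_one ρ)
      have h6 : (|w k| : ℤ) < (N : ℤ) + 1 := by exact_mod_cast h5
      omega
    exact abs_le.1 h2
  have hcard := Finset.card_le_card hsub
  have hTcard : T.card = (2 * N + 1) ^ 4 := by
    rw [hT, Fintype.card_piFinset, Finset.prod_const, Finset.card_univ, Fintype.card_fin, Int.card_Icc]
    congr 1
    omega
  rw [hTcard] at hcard
  calc (((B.filter fun w => ‖siteToE w‖ < ρ).card : ℕ) : ℝ) ≤ ((2 * N + 1) ^ 4 : ℕ) := by
        exact_mod_cast hcard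
    _ = (2 * (N : ℝ) + 1) ^ 4 := by push_cast; ring
    _ ≤ (2 * ρ + 1) ^ 4 := by
        have : (N : ℝ) ≤ ρ := Nat.floor_le hρ
        gcongr

/-! ## §2 Cube covariances: translation to the origin, continuity in the exterior -/

section Kernel

variable (G : Type) [Group G] [TopologicalSpace G] [IsTopologicalGroup G] [CompactSpace G]
  [MeasurableSpace G] [BorelSpace G] (r : LatticeRep G)

/-- **Translation covariance of cube covariances** (from `kerE_configShift`). [folklore] -/
theorem kerCov_configShift (v : Fin 4 → ℤ) (β : ℝ) (c : Fin 4 → ℤ) (b : ℕ) (η : LGConfig 4 G)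
    (F F' : LGConfig 4 G → ℝ) :
    kerCov G r β (c + v) b (configShift v η) F F' =
      kerCov G r β c b η (F ∘ configShift v) (F' ∘ configShift v) := by
  unfold kerCov
  rw [kerE_configShift, kerE_configShift, kerE_configShift]
  rfl

/-- The conditional covariance of `dens (z+w)`, `dens z` in the cube of radius `N` centred at `z` with exterior `ξ`
is the conditional covariance of `dens w`, `dens 0` in `[-N, N]⁴` with the translated exterior. [folklore] -/
theorem kerCov_dens_centred_eq (β : ℝ) (z w : Fin 4 → ℤ) (N : ℕ) (ξ : LGConfig 4 G) :
    kerCov G r β (fun j => z j - N) (2 * N + 1) ξ (dens G r (z + w)) (dens G r z) =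
      kerCov G r β (fun _ => -(N : ℤ)) (2 * N + 1) (configShift (-z) ξ) (dens G r w) (dens G r 0) := by
  have hc : (fun _ => -(N : ℤ)) + z = fun j => z j - N := by funext j; simp; ring
  have hU : configShift z (configShift (-z) ξ) = ξ := by
    rw [configShift_configShift, add_neg_cancel]; funext e; simp
  have key := kerCov_configShift G r z β (fun _ => -(N : ℤ)) (2 * N + 1) (configShift (-z) ξ)
    (dens G r (z + w)) (dens G r z)
  rw [hc, hU] at key
  rw [key]
  have h1 : dens G r (z + w) ∘ configShift z = dens G r w := by
    funext U
    simp only [Function.comp_apply]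
    rw [add_comm z w]
    exact dens_configShift G r z w U
  have h2 : dens G r z ∘ configShift z = dens G r 0 := by
    funext U
    simp only [Function.comp_apply]
    have := dens_configShift G r z 0 U
    rwa [zero_add] at this
  rw [h1, h2]

/-- Kernel means of a bounded continuous observable are continuous in the exterior (Feller property of the
lattice Yang–Mills specification). [folklore] -/
theorem continuous_kerE {F : LGConfig 4 G → ℝ} (hF : Continuous F) {M : ℝ} (hM : ∀ U, |F U| ≤ M) (β : ℝ)
    (c : Fin 4 → ℤ) (b : ℕ) : Continuous fun ξ => kerE G r β c b ξ F := by
  haveI := r.secondCountableTopology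
  unfold kerE
  exact continuous_integral_ymSpecification r.ρ r.continuous β (cubeEdges c b) hF hM

/-- Conditional covariances of two action densities are continuous in the exterior. [folklore] -/
theorem continuous_kerCov_dens (β : ℝ) (c : Fin 4 → ℤ) (b : ℕ) (x y : Fin 4 → ℤ) :
    Continuous fun ξ => kerCov G r β c b ξ (dens G r x) (dens G r y) := by
  obtain ⟨C, hC0, hC⟩ := exists_abs_dens_le G r
  have hxy : Continuous fun U : LGConfig 4 G => dens G r x U * dens G r y U :=
    (continuous_dens r x).mul (continuous_dens r y)
  have hbxy : ∀ U, |dens G r x U * dens G r y U| ≤ C * C := fun U => by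
    rw [abs_mul]; exact mul_le_mul (hC x U) (hC y U) (abs_nonneg _) hC0
  unfold kerCov
  exact (continuous_kerE G r hxy hbxy β c b).sub
    ((continuous_kerE G r (continuous_dens r x) (hC x) β c b).mul
      (continuous_kerE G r (continuous_dens r y) (hC y) β c b))

/-! ## §3 The law of total covariance through a sub-cube -/

/-- **Law of total covariance through a sub-cube, two-sided.**  For nested cubes `Q' ⊆ Q`, an exterior `η` of `Q`
and two sites `x, y` whose `Q'`-kernel means obey boundary laws `|kerE_ξ^{Q'}(dens x) − p| ≤ h`,
`|kerE_ξ^{Q'}(dens y) − q| ≤ h'` for every exterior `ξ`: the `Q`-covariance of `dens x, dens y` is within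
`4 h h'` of the `Q`-average of their `Q'`-covariances (DLR consistency `kerE_kerE_of_subset` + the abstract
`abs_cov_sub_integral_condCov_le`). [folklore] -/
theorem abs_kerCov_sub_kerE_kerCov_le (β : ℝ) {c c' : Fin 4 → ℤ} {b b' : ℕ}
    (hsub : cubeEdges c' b' ⊆ cubeEdges c b) (η : LGConfig 4 G) (x y : Fin 4 → ℤ) {p q h h' : ℝ}
    (hx : ∀ ξ, |kerE G r β c' b' ξ (dens G r x) - p| ≤ h) (hy : ∀ ξ, |kerE G r β c' b' ξ (dens G r y) - q| ≤ h') :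
    |kerCov G r β c b η (dens G r x) (dens G r y) -
        kerE G r β c b η (fun ξ => kerCov G r β c' b' ξ (dens G r x) (dens G r y))| ≤ 4 * h * h' := by
  haveI := r.secondCountableTopology
  haveI := isProbabilityMeasure_ymSpecification r.ρ r.continuous β (cubeEdges c b) η
  obtain ⟨C, hC0, hC⟩ := exists_abs_dens_le G r
  have hcx := continuous_dens r x
  have hcy := continuous_dens r y
  have hxy : Continuous fun U : LGConfig 4 G => dens G r x U * dens G r y U := hcx.mul hcy
  have hbxy : ∀ U, |dens G r x U * dens G r y U| ≤ C * C := fun U => by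
    rw [abs_mul]; exact mul_le_mul (hC x U) (hC y U) (abs_nonneg _) hC0
  have gA := continuous_kerE G r hcx (hC x) β c' b'
  have gB := continuous_kerE G r hcy (hC y) β c' b'
  have gAB := continuous_kerE G r hxy hbxy β c' b'
  have key := abs_cov_sub_integral_condCov_le (μ := ymSpecification (d := 4) r.ρ β (cubeEdges c b) η)
    gA gB gAB hx hy
  -- consistency: the `Q`-averages of the `Q'`-kernel means are the `Q`-kernel means
  have e1 : ∫ ξ, kerE G r β c' b' ξ (fun U => dens G r x U * dens G r y U)
      ∂(ymSpecification (d := 4) r.ρ β (cubeEdges c b) η) =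
      kerE G r β c b η (fun U => dens G r x U * dens G r y U) :=
    kerE_kerE_of_subset G r β hsub η hxy.measurable hbxy
  have e2 : ∫ ξ, kerE G r β c' b' ξ (dens G r x) ∂(ymSpecification (d := 4) r.ρ β (cubeEdges c b) η) =
      kerE G r β c b η (dens G r x) :=
    kerE_kerE_of_subset G r β hsub η hcx.measurable (hC x)
  have e3 : ∫ ξ, kerE G r β c' b' ξ (dens G r y) ∂(ymSpecification (d := 4) r.ρ β (cubeEdges c b) η) =
      kerE G r β c b η (dens G r y) :=
    kerE_kerE_of_subset G r β hsub η hcy.measurable (hC y)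
  rw [e1, e2, e3] at key
  unfold kerCov
  unfold kerE at key ⊢
  exact key


/-- **Law of total covariance for a weighted sum of near pairs.**  For nested cubes `Q' ⊆ Q`, an exterior `η` of
`Q`, a centre `z`, a finite index set `B` with real weights `ω` and reference values `n`, and boundary laws for the
`Q'`-kernel means of `dens z` (tolerance `h₀`) and of `dens (z+w)` at every weighted `w` (tolerance `h`): the weighted
sum of the `Q`-covariances is within `(Σ_w |ω w|)·4 h h₀` of the `Q`-average of the weighted sum of the
`Q'`-covariances. [folklore] -/
theorem abs_wsum_kerCov_sub_kerE_le (β : ℝ) {c c' : Fin 4 → ℤ} {b b' : ℕ}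
    (hsub : cubeEdges c' b' ⊆ cubeEdges c b) (η : LGConfig 4 G) (z : Fin 4 → ℤ) (B : Finset (Fin 4 → ℤ))
    (ω n : (Fin 4 → ℤ) → ℝ) {p h h₀ : ℝ}
    (hz : ∀ ξ, |kerE G r β c' b' ξ (dens G r z) - p| ≤ h₀)
    (hw : ∀ w ∈ B, ω w ≠ 0 → ∀ ξ, |kerE G r β c' b' ξ (dens G r (z + w)) - p| ≤ h) :
    |∑ w ∈ B, ω w * (kerCov G r β c b η (dens G r (z + w)) (dens G r z) - n w) -
        kerE G r β c b η (fun ξ => ∑ w ∈ B, ω w * (kerCov G r β c' b' ξ (dens G r (z + w)) (dens G r z) - n w))|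
      ≤ (∑ w ∈ B, |ω w|) * (4 * h * h₀) := by
  haveI := r.secondCountableTopology
  haveI := isProbabilityMeasure_ymSpecification r.ρ r.continuous β (cubeEdges c b) η
  -- linearity of the `Q`-kernel mean over the finite sum
  have hlin : kerE G r β c b η
      (fun ξ => ∑ w ∈ B, ω w * (kerCov G r β c' b' ξ (dens G r (z + w)) (dens G r z) - n w)) =
      ∑ w ∈ B, ω w * (kerE G r β c b η (fun ξ => kerCov G r β c' b' ξ (dens G r (z + w)) (dens G r z)) - n w) := by
    have hint : ∀ w ∈ B, Integrable (fun ξ : LGConfig 4 G =>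
        ω w * (kerCov G r β c' b' ξ (dens G r (z + w)) (dens G r z) - n w))
        (ymSpecification (d := 4) r.ρ β (cubeEdges c b) η) := fun w _ =>
      (integrable_of_continuous_compact
        ((continuous_kerCov_dens G r β c' b' (z + w) z).sub continuous_const)).const_mul (ω w)
    unfold kerE
    rw [integral_finsetSum B hint]
    refine Finset.sum_congr rfl fun w _ => ?_
    rw [integral_const_mul, integral_sub (integrable_of_continuous_compact (continuous_kerCov_dens G r β c' b' (z + w) z))
      (integrable_const _), integral_const, probReal_univ, one_smul]
  rw [hlin, ← Finset.sum_sub_distrib]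
  have hterm : ∀ w ∈ B,
      |ω w * (kerCov G r β c b η (dens G r (z + w)) (dens G r z) - n w) -
          ω w * (kerE G r β c b η (fun ξ => kerCov G r β c' b' ξ (dens G r (z + w)) (dens G r z)) - n w)|
        ≤ |ω w| * (4 * h * h₀) := by
    intro w hwB
    have e : ω w * (kerCov G r β c b η (dens G r (z + w)) (dens G r z) - n w) -
        ω w * (kerE G r β c b η (fun ξ => kerCov G r β c' b' ξ (dens G r (z + w)) (dens G r z)) - n w) =
        ω w * (kerCov G r β c b η (dens G r (z + w)) (dens G r z) -
          kerE G r β c b η (fun ξ => kerCov G r β c' b' ξ (dens G r (z + w)) (dens G r z))) := by ring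
    rw [e, abs_mul]
    by_cases hω : ω w = 0
    · rw [hω]; simp
    · exact mul_le_mul_of_nonneg_left
        (abs_kerCov_sub_kerE_kerCov_le G r β hsub η (z + w) z (hw w hwB hω) hz) (abs_nonneg _)
  calc |∑ w ∈ B, (ω w * (kerCov G r β c b η (dens G r (z + w)) (dens G r z) - n w) -
          ω w * (kerE G r β c b η (fun ξ => kerCov G r β c' b' ξ (dens G r (z + w)) (dens G r z)) - n w))|
        ≤ ∑ w ∈ B, |ω w * (kerCov G r β c b η (dens G r (z + w)) (dens G r z) - n w) -
          ω w * (kerE G r β c b η (fun ξ => kerCov G r β c' b' ξ (dens G r (z + w)) (dens G r z)) - n w)| :=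
        Finset.abs_sum_le_sum_abs _ _
    _ ≤ ∑ w ∈ B, |ω w| * (4 * h * h₀) := Finset.sum_le_sum hterm
    _ = (∑ w ∈ B, |ω w|) * (4 * h * h₀) := by rw [Finset.sum_mul]

/-- The kernel mean of a continuous function of the exterior that stays within `ε` of a constant stays within `ε`
of it. [folklore] -/
theorem abs_kerE_sub_le_of_forall (β : ℝ) (c : Fin 4 → ℤ) (b : ℕ) (η : LGConfig 4 G) {Gf : LGConfig 4 G → ℝ}
    (hG : Continuous Gf) {c₀ ε : ℝ} (h : ∀ ξ, |Gf ξ - c₀| ≤ ε) : |kerE G r β c b η Gf - c₀| ≤ ε := by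
  haveI := r.secondCountableTopology
  haveI := isProbabilityMeasure_ymSpecification r.ρ r.continuous β (cubeEdges c b) η
  unfold kerE
  exact abs_integral_sub_const_le hG h

end Kernel

/-! ## §4 Arithmetic of the reduction -/

/-- The largest admissible radius `⌊(ℓ/a − 1)/2⌋₊` dominates every admissible radius and is admissible.
[folklore] -/
theorem floor_radius_admissible {ℓ a : ℝ} (ha : 0 < a) {N : ℕ} (hN : ((2 * N + 1 : ℕ) : ℝ) * a ≤ ℓ) :
    N ≤ ⌊(ℓ / a - 1) / 2⌋₊ ∧ ((2 * ⌊(ℓ / a - 1) / 2⌋₊ + 1 : ℕ) : ℝ) * a ≤ ℓ := by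
  have h1 : (2 * (N : ℝ) + 1) * a ≤ ℓ := by push_cast at hN; exact hN
  have h2 : 2 * (N : ℝ) + 1 ≤ ℓ / a := by rw [le_div_iff₀ ha]; exact h1
  have h3 : (N : ℝ) ≤ (ℓ / a - 1) / 2 := by linarith
  have h0 : 0 ≤ (ℓ / a - 1) / 2 := le_trans (Nat.cast_nonneg N) h3
  refine ⟨Nat.le_floor h3, ?_⟩
  have h4 : (⌊(ℓ / a - 1) / 2⌋₊ : ℝ) ≤ (ℓ / a - 1) / 2 := Nat.floor_le h0
  have h5 : (2 * (⌊(ℓ / a - 1) / 2⌋₊ : ℝ) + 1) ≤ ℓ / a := by linarith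
  have h6 := (le_div_iff₀ ha).1 h5
  push_cast
  exact h6

/-- The radial weights of the signed sum are supported in the lattice ball of radius `R/a` and bounded by `1`, so
their absolute sum is at most `(2R/a + 1)⁴`. [folklore] -/
theorem sum_abs_weight_le (B : Finset (Fin 4 → ℤ)) {a R : ℝ} (ha : 0 < a) (hR : 0 ≤ R) (φ : ℝ → ℝ)
    (hφ1 : ∀ t, |φ t| ≤ 1) (hφR : ∀ t, R ≤ t → φ t = 0) :
    ∑ w ∈ B, |φ (a * ‖siteToE w‖)| ≤ (2 * (R / a) + 1) ^ 4 := by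
  classical
  have hle : ∀ w ∈ B, |φ (a * ‖siteToE w‖)| ≤ if ‖siteToE w‖ < R / a then (1 : ℝ) else 0 := by
    intro w _
    split_ifs with hlt
    · exact hφ1 _
    · push Not at hlt
      have hge : R ≤ a * ‖siteToE w‖ := by
        rw [div_le_iff₀ ha] at hlt; linarith [hlt]
      rw [hφR _ hge, abs_zero]
  refine (Finset.sum_le_sum hle).trans ?_
  rw [Finset.sum_boole]
  exact card_filter_norm_lt_le_pow B (div_nonneg hR ha.le)

/-- The final bookkeeping: with `t ≤ 1/2`, `t ≤ κ/(20736 (C₁²+1))`, `X ≤ 3 t D` the second-order remainder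
`X⁴ · 4 · (16 C₁/D⁴) · (C₁/D⁴)` is at most `κ/(4 D⁴)`. [folklore] -/
theorem remainder_le {κ C₁ t D X : ℝ} (hκ : 0 < κ) (ht0 : 0 < t) (ht1 : t ≤ 1 / 2)
    (htκ : t ≤ κ / (20736 * (C₁ ^ 2 + 1))) (hD : 0 < D) (hX0 : 0 ≤ X) (hX : X ≤ 3 * t * D) :
    X ^ 4 * (4 * (16 * C₁ / D ^ 4) * (C₁ / D ^ 4)) ≤ κ / 4 / D ^ 4 := by
  have hD4 : 0 < D ^ 4 := by positivity
  have hX4 : X ^ 4 ≤ (3 * t * D) ^ 4 := pow_le_pow_left₀ hX0 hX 4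
  have ht4 : t ^ 4 ≤ t * (1 / 8) := by
    have ht3 : t ^ 3 ≤ (1 / 2) ^ 3 := pow_le_pow_left₀ ht0.le ht1 3
    nlinarith
  have hC : C₁ ^ 2 * t ≤ κ / 20736 := by
    have h1 : C₁ ^ 2 * t ≤ (C₁ ^ 2 + 1) * t := by nlinarith
    have h2 : (C₁ ^ 2 + 1) * t ≤ (C₁ ^ 2 + 1) * (κ / (20736 * (C₁ ^ 2 + 1))) :=
      mul_le_mul_of_nonneg_left htκ (by positivity)
    have h3 : (C₁ ^ 2 + 1) * (κ / (20736 * (C₁ ^ 2 + 1))) = κ / 20736 := by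
      field_simp
    linarith
  have key : X ^ 4 * (4 * (16 * C₁ / D ^ 4) * (C₁ / D ^ 4)) = 64 * C₁ ^ 2 * X ^ 4 / D ^ 4 / D ^ 4 := by
    field_simp
    ring
  rw [key, div_le_div_iff_of_pos_right hD4, div_le_iff₀ hD4]
  calc 64 * C₁ ^ 2 * X ^ 4 ≤ 64 * C₁ ^ 2 * (3 * t * D) ^ 4 := by gcongr
    _ = 5184 * (C₁ ^ 2 * t ^ 4) * D ^ 4 := by ring
    _ ≤ 5184 * (C₁ ^ 2 * (t * (1 / 8))) * D ^ 4 := by gcongr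
    _ = 648 * (C₁ ^ 2 * t) * D ^ 4 := by ring
    _ ≤ 648 * (κ / 20736) * D ^ 4 := by gcongr
    _ ≤ κ / 4 * D ^ 4 := by nlinarith [hD4]

end Summit.QuantumFields.YangMills.Cruxes.ResponseLocalisation.CentredOsc

end
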